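import Mathlib
import HarnessLib
import Literature.MathematicalPhysics.QuantumFieldTheory.ConstructiveQFTWave0

/-!
# Lattice coverings: pulling a gauge field back along a coordinatewise ring map of sites `x ↦ (φ xᵢ)ᵢ` — fibres, sums and products along the map, the Wilson action is multiplied by the number of sheets; schedules of layers on two spaces intertwined by a map

HONEST FRAMING: exact (Metropolis-corrected) sampling algorithms for lattice gauge theory;
figures of merit are autocorrelation/cost numbers at stated couplings and volumes; no
continuum-physics claim.

Venture `LatticeQCDFlow` (cell pub-lqcd), topic `Exactness`; FANOUT row 14 (`eng-flowhmc`, engine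
`latflow.fthmc`, family B, on the periodic torus `Site d L = (Fin d → ZMod L)` of the Literature's
`ConstructiveQFTWave0`).  NEW WORK of the cell; nothing is cited as a fact; no number.  First file of the
VOLUME-UNIFORMITY chain (GEN-15): the exact force through the engine's member on the `L`-torus will be
compared with the force on a fixed reference torus through a common covering torus; this file holds the
group-agnostic lattice part.

## Setting

A ring map `φ : ZMod L' →+* ZMod L` (for `L ∣ L'`: `ZMod.castHom`, the covering `(ℤ/L')^d → (ℤ/L)^d`),
the site map `σ x = (φ (x i))ᵢ`, the edge map `σ̂ (x, μ) = (σ x, μ)`, the PULL-BACK of fields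
`(V∘σ̂)(e') = V (σ e'.1, e'.2)` (written `fun e : Edge d L' => V (fun i => φ (e.1 i), e.2)`), and
`N = #{x' : σ x' = 0}`, the common cardinality of the fibres of `σ` when `φ` is onto.

## Content (statements about explicit expressions; no definition is introduced)

* §1 schedules of layers on TWO measurable spaces related by a map `Θ : Ω → Ω'` (the two-space form
  of `SU2WilsonFlowLOTranslation`'s packaging lemmas): `forall₂_of_layers_map_eq` (transfer through the
  `layers.map … = sched.map …` packaging), `foldr_trans_semiconj` (`F'(Θ v) = Θ(F v)` for the
  composites), `foldr_logDet_semiconj_pow` (`J'(Θ v) = J(v)^N` for the running densities);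
* §2 site maps: `siteMap_shift`, `siteMap_sub_single`, `siteMap_add`, `siteMap_surjective`,
  `card_fibre_siteMap` (all fibres have `N` elements), **`prod_comp_siteMap`** / **`sum_comp_siteMap`**
  (`∏_{x'} g(σ x') = (∏_y g y)^N`, `∑_{x'} g(σ x') = N • ∑_y g y`), `prod_comp_edgeMap`,
  `sum_comp_edgeMap`, **`prod_active_comp_siteMap`** (a product over an active class of edges whose
  preimage is the active class upstairs);
* §3 any group: `plaquetteHolonomy_pull` (`U_p(V∘σ̂)(x') = U_p(V)(σ x')`), **`wilsonAction_pull`**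
  (`S_W(V∘σ̂) = N·S_W(V)` for every matrix representation).

NOT CLAIMED: maps of sites that are not coordinatewise ring maps (translations:
`SU2WilsonFlowLOTranslation`); any number.
-/

noncomputable section

namespace Summit.Ventures.LatticeQCDFlow.Exactness

open Real Set MeasureTheory InnerProductGeometry WithLp
open Literature.MathematicalPhysics.QuantumFieldTheory

/-! ## §1 Schedules of layers on two spaces related by a map of the data -/

section Package

variable {Ω Ω' : Type*} [MeasurableSpace Ω] [MeasurableSpace Ω']

/-- **Transfer through the `exists_layers_*` packaging, two spaces.**  If `layers` (on `Ω`) and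
`layers'` (on `Ω'`) ARE, position by position, the maps/densities `Fm s, Jm s` and `Fm' s, Jm' s` of the
SAME schedule, and for every schedule entry `Fm' s ∘ Θ = Θ ∘ Fm s` and `Jm' s ∘ Θ = (Jm s)^N`, then the
two lists are related entry by entry in the same way. -/
theorem forall₂_of_layers_map_eq {σ : Type*} (Θ : Ω → Ω') (N : ℕ)
    (layers : List ((Ω ≃ᵐ Ω) × (Ω → ℝ))) (layers' : List ((Ω' ≃ᵐ Ω') × (Ω' → ℝ)))
    (sched : List σ) (Fm : σ → Ω → Ω) (Jm : σ → Ω → ℝ) (Fm' : σ → Ω' → Ω') (Jm' : σ → Ω' → ℝ)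
    (hmap : layers.map (fun Ly => ((Ly.1 : Ω → Ω), Ly.2)) = sched.map (fun s => (Fm s, Jm s)))
    (hmap' : layers'.map (fun Ly => ((Ly.1 : Ω' → Ω'), Ly.2)) = sched.map (fun s => (Fm' s, Jm' s)))
    (hF : ∀ s ∈ sched, ∀ v, Fm' s (Θ v) = Θ (Fm s v)) (hJ : ∀ s ∈ sched, ∀ v, Jm' s (Θ v) = Jm s v ^ N) :
    List.Forall₂ (fun Ly Ly' => (∀ v, Ly'.1 (Θ v) = Θ (Ly.1 v)) ∧ (∀ v, Ly'.2 (Θ v) = Ly.2 v ^ N)) layers layers' := by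
  induction sched generalizing layers layers' with
  | nil =>
    rw [List.map_nil, List.map_eq_nil_iff] at hmap hmap'
    subst hmap
    subst hmap'
    exact List.Forall₂.nil
  | cons s rest ih =>
    obtain ⟨Ly, tl, rfl⟩ : ∃ Ly tl, layers = Ly :: tl := by
      cases layers with
      | nil => simp at hmap
      | cons Ly tl => exact ⟨Ly, tl, rfl⟩
    obtain ⟨Ly', tl', rfl⟩ : ∃ Ly' tl', layers' = Ly' :: tl' := by
      cases layers' with
      | nil => simp at hmap'
      | cons Ly' tl' => exact ⟨Ly', tl', rfl⟩
    rw [List.map_cons, List.map_cons, List.cons.injEq] at hmap hmap'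
    have h1 : (Ly.1 : Ω → Ω) = Fm s := (Prod.mk.inj hmap.1).1
    have h2 : Ly.2 = Jm s := (Prod.mk.inj hmap.1).2
    have h1' : (Ly'.1 : Ω' → Ω') = Fm' s := (Prod.mk.inj hmap'.1).1
    have h2' : Ly'.2 = Jm' s := (Prod.mk.inj hmap'.1).2
    refine List.Forall₂.cons ⟨fun v => ?_, fun v => ?_⟩
      (ih tl tl' hmap.2 hmap'.2 (fun s' hs' => hF s' (List.mem_cons_of_mem _ hs'))
        (fun s' hs' => hJ s' (List.mem_cons_of_mem _ hs')))
    · rw [h1, h1']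
      exact hF s List.mem_cons_self v
    · rw [h2, h2']
      exact hJ s List.mem_cons_self v

/-- **A member built from intertwined layers is intertwined**: if `Ly'.1 ∘ Θ = Θ ∘ Ly.1` entry by
entry, the composites `F' = F'_n ∘ ⋯ ∘ F'_1` and `F = F_n ∘ ⋯ ∘ F_1` satisfy `F' ∘ Θ = Θ ∘ F`. -/
theorem foldr_trans_semiconj (Θ : Ω → Ω') (layers : List ((Ω ≃ᵐ Ω) × (Ω → ℝ)))
    (layers' : List ((Ω' ≃ᵐ Ω') × (Ω' → ℝ)))
    (h : List.Forall₂ (fun Ly Ly' => ∀ v, Ly'.1 (Θ v) = Θ (Ly.1 v)) layers layers') (v : Ω) :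
    (layers'.foldr (fun Ly (G : Ω' ≃ᵐ Ω') => Ly.1.trans G) (MeasurableEquiv.refl Ω')) (Θ v) =
      Θ ((layers.foldr (fun Ly (G : Ω ≃ᵐ Ω) => Ly.1.trans G) (MeasurableEquiv.refl Ω)) v) := by
  induction h generalizing v with
  | nil => rfl
  | cons hd _ ih =>
    rw [List.foldr_cons, List.foldr_cons, MeasurableEquiv.coe_trans, MeasurableEquiv.coe_trans,
      Function.comp_apply, Function.comp_apply, hd v]
    exact ih _

/-- **The running density of an intertwined member whose layer densities pull back to `N`-th powers
pulls back to the `N`-th power**: `J'(Θ v) = J(v)^N` for the accumulated densities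
`v ↦ J_1(v) · J_2(F_1 v) ⋯`. -/
theorem foldr_logDet_semiconj_pow (Θ : Ω → Ω') (N : ℕ) (layers : List ((Ω ≃ᵐ Ω) × (Ω → ℝ)))
    (layers' : List ((Ω' ≃ᵐ Ω') × (Ω' → ℝ)))
    (h : List.Forall₂ (fun Ly Ly' => (∀ v, Ly'.1 (Θ v) = Θ (Ly.1 v)) ∧ (∀ v, Ly'.2 (Θ v) = Ly.2 v ^ N)) layers layers')
    (v : Ω) :
    (layers'.foldr (fun Ly K => fun v => Ly.2 v * K (Ly.1 v)) (fun _ => (1 : ℝ))) (Θ v) =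
      ((layers.foldr (fun Ly K => fun v => Ly.2 v * K (Ly.1 v)) (fun _ => (1 : ℝ))) v) ^ N := by
  induction h generalizing v with
  | nil => simp only [List.foldr_nil, one_pow]
  | cons hd _ ih =>
    simp only [List.foldr_cons]
    rw [hd.2 v, hd.1 v, ih, mul_pow]

end Package

/-! ## §2 Coordinatewise site maps `x ↦ (φ xᵢ)ᵢ`, their fibres, sums and products along them -/

section SiteMap

variable {d L L' : ℕ} (φ : ZMod L' →+* ZMod L)

/-- `σ (x + e_i) = σ x + e_i`. -/
theorem siteMap_shift (x : Site d L') (i : Fin d) :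
    (fun j => φ ((Site.shift x i) j)) = Site.shift (fun j => φ (x j)) i := by
  funext j
  simp only [Site.shift, Pi.add_apply, map_add]
  by_cases h : j = i
  · subst h
    simp only [Pi.single_eq_same, map_one]
  · simp only [Pi.single_eq_of_ne h, map_zero]

/-- `σ (x − e_ν) = σ x − e_ν`. -/
theorem siteMap_sub_single (x : Site d L') (ν : Fin d) :
    (fun j => φ ((x - Pi.single ν 1 : Site d L') j)) = (fun j => φ (x j)) - Pi.single ν 1 := by
  funext j
  simp only [Pi.sub_apply, map_sub]
  by_cases h : j = ν
  · subst h
    simp only [Pi.single_eq_same, map_one]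
  · simp only [Pi.single_eq_of_ne h, map_zero]

/-- `σ` is additive. -/
theorem siteMap_add (x t : Site d L') :
    (fun j => φ ((x + t) j)) = (fun j => φ (x j)) + fun j => φ (t j) := by
  funext j
  simp only [Pi.add_apply, map_add]

/-- `σ` is onto when `φ` is. -/
theorem siteMap_surjective (hφ : Function.Surjective φ) :
    Function.Surjective (fun x : Site d L' => fun j => φ (x j)) := by
  intro y
  choose g hg using hφ
  exact ⟨fun j => g (y j), funext fun j => hg (y j)⟩

variable [NeZero L] [NeZero L']

omit [NeZero L] in
/-- **All fibres of `σ` have the same cardinality** `N = #{x' : σ x' = 0}` (translate by a preimage). -/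
theorem card_fibre_siteMap (hφ : Function.Surjective φ) (y : Site d L) :
    Fintype.card {x : Site d L' // (fun j => φ (x j)) = y} =
      Fintype.card {x : Site d L' // (fun j => φ (x j)) = 0} := by
  obtain ⟨x₀, hx₀⟩ := siteMap_surjective φ hφ y
  have hx₀' : (fun j => φ (x₀ j)) = y := hx₀
  refine Fintype.card_congr ((Equiv.subRight x₀).subtypeEquiv fun x => ?_)
  have hsub : (fun j => φ ((x - x₀) j)) = (fun j => φ (x j)) - fun j => φ (x₀ j) := by
    funext j
    simp only [Pi.sub_apply, map_sub]
  rw [Equiv.subRight_apply, hsub, hx₀', sub_eq_zero]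

/-- **Products along `σ`**: `∏_{x'} g(σ x') = (∏_y g y)^N`. -/
theorem prod_comp_siteMap {M : Type*} [CommMonoid M] (hφ : Function.Surjective φ) (g : Site d L → M) :
    ∏ x : Site d L', g (fun j => φ (x j)) =
      (∏ y : Site d L, g y) ^ Fintype.card {x : Site d L' // (fun j => φ (x j)) = 0} := by
  rw [Finset.prod_comp, Finset.image_univ_of_surjective (siteMap_surjective φ hφ), ← Finset.prod_pow]
  refine Finset.prod_congr rfl fun y _ => ?_
  rw [← card_fibre_siteMap φ hφ y, Fintype.card_subtype]

/-- **Sums along `σ`**: `∑_{x'} g(σ x') = N • ∑_y g y`. -/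
theorem sum_comp_siteMap {M : Type*} [AddCommMonoid M] (hφ : Function.Surjective φ) (g : Site d L → M) :
    ∑ x : Site d L', g (fun j => φ (x j)) =
      Fintype.card {x : Site d L' // (fun j => φ (x j)) = 0} • ∑ y : Site d L, g y := by
  rw [Finset.sum_comp, Finset.image_univ_of_surjective (siteMap_surjective φ hφ), Finset.smul_sum]
  refine Finset.sum_congr rfl fun y _ => ?_
  rw [← card_fibre_siteMap φ hφ y, Fintype.card_subtype]

/-- Products along the edge map `σ̂ (x, μ) = (σ x, μ)`: `∏_{e'} g(σ̂ e') = (∏_e g e)^N`. -/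
theorem prod_comp_edgeMap {M : Type*} [CommMonoid M] (hφ : Function.Surjective φ) (g : Edge d L → M) :
    ∏ e : Edge d L', g ((fun j => φ (e.1 j)), e.2) =
      (∏ e : Edge d L, g e) ^ Fintype.card {x : Site d L' // (fun j => φ (x j)) = 0} := by
  rw [Fintype.prod_prod_type, Fintype.prod_prod_type,
    prod_comp_siteMap φ hφ (fun y => ∏ μ : Fin d, g (y, μ))]

/-- Sums along the edge map: `∑_{e'} g(σ̂ e') = N • ∑_e g e`. -/
theorem sum_comp_edgeMap {M : Type*} [AddCommMonoid M] (hφ : Function.Surjective φ) (g : Edge d L → M) :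
    ∑ e : Edge d L', g ((fun j => φ (e.1 j)), e.2) =
      Fintype.card {x : Site d L' // (fun j => φ (x j)) = 0} • ∑ e : Edge d L, g e := by
  rw [Fintype.sum_prod_type, Fintype.sum_prod_type,
    sum_comp_siteMap φ hφ (fun y => ∑ μ : Fin d, g (y, μ))]

/-- **Products over an active class pulled back**: if the class `p'` on `Edge d L'` is the preimage of
the class `p` on `Edge d L`, then `∏_{a' ∈ p'} g(σ̂ a') = (∏_{a ∈ p} g a)^N`. -/
theorem prod_active_comp_siteMap {M : Type*} [CommMonoid M] (hφ : Function.Surjective φ)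
    (p : Edge d L → Prop) [DecidablePred p] (p' : Edge d L' → Prop) [DecidablePred p']
    (hp : ∀ e : Edge d L', p' e ↔ p ((fun j => φ (e.1 j)), e.2)) (g : Edge d L → M) :
    ∏ a : {e : Edge d L' // p' e}, g ((fun j => φ (a.1.1 j)), a.1.2) =
      (∏ a : {e : Edge d L // p e}, g a.1) ^ Fintype.card {x : Site d L' // (fun j => φ (x j)) = 0} := by
  have hfilter : Finset.univ.filter p' = Finset.univ.filter (fun e : Edge d L' => p ((fun j => φ (e.1 j)), e.2)) :=
    Finset.filter_congr fun e _ => hp e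
  rw [← Finset.prod_subtype (Finset.univ.filter p') (fun e => by simp only [Finset.mem_filter, Finset.mem_univ, true_and])
      (fun e : Edge d L' => g ((fun j => φ (e.1 j)), e.2)),
    ← Finset.prod_subtype (Finset.univ.filter p) (fun e => by simp only [Finset.mem_filter, Finset.mem_univ, true_and])
      g,
    hfilter, Finset.prod_filter, Finset.prod_filter]
  exact prod_comp_edgeMap φ hφ (fun e => if p e then g e else 1)

end SiteMap

/-! ## §3 Any group: plaquettes and the Wilson action under pull-back -/

section Lattice

variable {d L L' : ℕ} (φ : ZMod L' →+* ZMod L) {G : Type*} [Group G]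

/-- **Plaquette holonomies pull back**: `U_p(V∘σ̂)` at `x'` is `U_p(V)` at `σ x'`. -/
theorem plaquetteHolonomy_pull (V : GaugeConfig d L G) (x : Site d L') (i j : Fin d) :
    plaquetteHolonomy (fun e : Edge d L' => V (fun k => φ (e.1 k), e.2)) x i j =
      plaquetteHolonomy V (fun k => φ (x k)) i j := by
  simp only [plaquetteHolonomy, siteMap_shift]

variable [NeZero L] [NeZero L']

/-- **The Wilson action of a pulled-back field is `N` times the Wilson action**:
`S_W(V∘σ̂) = N·S_W(V)` for every matrix representation `ρ` (every plaquette of the `L`-torus has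
exactly `N` lifts). -/
theorem wilsonAction_pull {n : ℕ} (ρ : G →* Matrix (Fin n) (Fin n) ℂ) (hφ : Function.Surjective φ)
    (V : GaugeConfig d L G) :
    wilsonAction ρ (fun e : Edge d L' => V (fun k => φ (e.1 k), e.2)) =
      (Fintype.card {x : Site d L' // (fun j => φ (x j)) = 0} : ℝ) * wilsonAction ρ V := by
  unfold wilsonAction
  simp only [plaquetteHolonomy_pull]
  rw [Fintype.sum_prod_type, Fintype.sum_prod_type,
    sum_comp_siteMap φ hφ (fun y => ∑ q : {p : Fin d × Fin d // p.1 < p.2},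
      ((n : ℝ) - (ρ (plaquetteHolonomy V y q.1.1 q.1.2)).trace.re)), nsmul_eq_mul]

end Lattice

/-! ## §4 Pull-back commutes with gauge transformations and intertwines translations

(Appended, GEN-15.)  The covering construction is compatible with the two symmetries the cell has typed
for its kernels (`SU2FTHMCGaugeCovariance*`, `SU2*TranslationCovariance`): pulling back a gauge-transformed
field is gauge-transforming the pulled-back field by the pulled-back gauge function, and translating a
pulled-back field by `t'` upstairs is pulling back the field translated by `σ t'` downstairs. -/

section Symmetries

variable {d L L' : ℕ} (φ : ZMod L' →+* ZMod L) {G : Type*}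

/-- **Pull-back commutes with gauge transformations** (any group): `(V^g)∘σ̂ = (V∘σ̂)^{g∘σ}`. -/
theorem gaugeTransform_pull [Group G] (g : Site d L → G) (V : GaugeConfig d L G) :
    (fun e : Edge d L' => (gaugeTransform g V) (fun i => φ (e.1 i), e.2)) =
      gaugeTransform (fun x : Site d L' => g (fun i => φ (x i)))
        (fun e : Edge d L' => V (fun i => φ (e.1 i), e.2)) := by
  funext e
  simp only [gaugeTransform, siteMap_shift]

/-- **Pull-back intertwines translations** (any link type): `(V∘σ̂)·t' = (V·(σ t'))∘σ̂`. -/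
theorem translate_pull (t : Site d L') (V : GaugeConfig d L G) :
    (fun e : Edge d L' => (fun e' : Edge d L' => V (fun i => φ (e'.1 i), e'.2)) (e.1 + t, e.2)) =
      fun e : Edge d L' => (fun e' : Edge d L => V (e'.1 + (fun i => φ (t i)), e'.2)) (fun i => φ (e.1 i), e.2) := by
  funext e
  simp only [siteMap_add]

end Symmetries

end Summit.Ventures.LatticeQCDFlow.Exactness
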